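import Summits.AnomalousDissipation.AnomalousDissipation.Theorems.SawtoothPulseCascadeK1LocalisedCascadeDatumSpectrum
import Literature.Analysis.FluidPDE.DEIJCriterion
import Literature.Analysis.FluidPDE.PassiveScalarClassicalWeak
import Literature.Analysis.FluidPDE.PassiveScalarEnergyProofs
import HarnessLib

/-!
# K1 `K1BoundedStrainCascade` (aside, stmt-AnomalousDissipation-20026), line `Birth` — STUB 3 `stub_criterionTransfer`

Registered stub `stub_criterionTransfer` of the line `Birth` (reshape r1, skeleton sha `07dcd01a`): for EVERY parameter
point `P`, field regularity (`CascadeFieldSmooth P` and essential boundedness of the lift of `ū = P.field` on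
`(0,1) × 𝕋²`) and the inviscid balanced-growth package of the DEIJ / Elgindi–Liss criterion (an inviscid solution `g`
from `sin 2πx₁`, smooth classical on every `[0,T₁]`, `T₁ < 1`, with non-increasing `L²`, unbounded cumulative enstrophy
as `t → 1` and `‖Δg‖ ≤ C‖∇g‖²`) imply the route's `K1FixedFraction P`.

The transfer is the tree's criterion `Torus.DEIJ.le_eScalarDissipation_of_balanced_growth` (`DEIJCriterion`,
Drivas–Elgindi–Iyer–Jeong 2022 Prop. 1.3 in the Elgindi–Liss `H²` form; there `κ∫₀¹‖∇θ‖² ≥ 1/(32C²)` for every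
weak solution with `κ > 0` and datum within `1/(8C²)` of `g 0`), applied with horizon `T = 1`, datum `θ₀ = datum =
g 0` (distance `0`) and `χ = 1/(32 C² ‖datum‖²)`; its one missing input is that a CLASSICAL solution on the
half-open interval `[0, 1)` with an essentially bounded drift is a WEAK solution on `[0,1)`
(`isWeakScalarTransportOn_of_Ico`): every test function vanishes from some `T' < 1` on, so the weak identity is the
tree's closed-interval bridge `Torus.IsClassicalScalarTransportOn.isWeakScalarTransportOn_holds` on `[0, T'']`,
`T' < T'' < 1`; the class bounds `θ ∈ L^∞_t L²_x` (energy decay `antitoneOn_scalarL2Sq`), `u ∈ L¹_t L²_x`,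
`|u||θ| ∈ L¹` (drift bound `ae_ae_norm_le_of_memLp_top_stLift`, `|θ| ≤ |θ|² + 1`; `‖datum‖² = ½`, `K1Start.scalarL2Sq_datum`) and weak incompressibility
(`IsDivFree.isWeaklyDivFree_holds`) are bookkeeping.  No new definitions, no named facts.
-/

-- `Summit.<Summit>.<Problem>`: single-conjunct summit, the duplicate namespace segment is deliberate.
set_option linter.dupNamespace false

noncomputable section

open MeasureTheory Set Filter Topology
open scoped NNReal ENNReal InnerProductSpace
open Literature.Analysis Literature.Analysis.FunctionSpaces Literature.Analysis.FluidPDE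
open Literature.Analysis.FluidPDE.SawtoothCascade
open Literature.Analysis.FluidPDE.Torus

namespace Summit.AnomalousDissipation.AnomalousDissipation.Theorems.SawtoothPulseCascade.K1BoundedStrainCascadeBirth

/-! ## A classical solution on `[0, T)` with bounded drift is a weak solution on `[0, T)` -/

/-- For `f ∈ L²(T^d)`: `∫⁻ ‖f‖ₑ² = ofReal (scalarL2Sq f)`. [folklore] -/
theorem lintegral_enorm_sq_eq_ofReal_scalarL2Sq {d : Type*} [Fintype d] {f : UnitAddTorus d → ℝ}
    (hf : MemLp f 2 volume) : ∫⁻ x, ‖f x‖ₑ ^ 2 = ENNReal.ofReal (scalarL2Sq f) := by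
  -- adapted from Literature/Analysis/FluidPDE/AgeDecouplingGridPairing.lean (`ofReal_scalarL2Sq_eq`)
  rw [scalarL2Sq, ofReal_integral_eq_lintegral_ofReal hf.integrable_sq (ae_of_all _ fun x => sq_nonneg _)]
  refine lintegral_congr fun x => ?_
  rw [Real.enorm_eq_ofReal_abs, ← ENNReal.ofReal_pow (abs_nonneg _), sq_abs]

/-- **Classical on the half-open interval ⇒ weak.** A classical solution of `∂ₜθ + u·∇θ = κΔθ`, `div u = 0`
(`κ ≥ 0`) on the HALF-OPEN time interval `[0, T)` (`T > 0`) whose drift is essentially bounded on `(0,T) × T^d`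
is a weak solution on `T^d × [0, T)` with datum `θ 0` (DiPerna–Lions 1989 §II.1 (12)–(14)): the test functions of
the weak formulation vanish from some `T' < T` on, so the weak identity is the closed-interval statement
`IsClassicalScalarTransportOn.isWeakScalarTransportOn_holds` on `[0, T'']`, `T' < T'' < T`; `θ ∈ L^∞_t L²_x` by the
energy decay, the drift clauses by the `L^∞` bound. [cite: DiPernaLions1989, §II.1 (12)–(14)] -/
theorem isWeakScalarTransportOn_of_Ico {d : Type*} [Fintype d] [DecidableEq d] {κ T : ℝ} (hT : 0 < T)
    {u : ℝ → UnitAddTorus d → EuclideanSpace ℝ d} {θ : ℝ → UnitAddTorus d → ℝ}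
    (h : IsClassicalScalarTransportOn (Ico 0 T) κ u θ) (hκ : 0 ≤ κ)
    (hu : MemLp (FunctionSpaces.Torus.stLift u) ∞ (volume.restrict (Ioo 0 T ×ˢ univ))) :
    IsWeakScalarTransportOn T κ u (θ 0) θ := by
  have hθs := h.smooth_scalar
  have hus := h.smooth_velocity
  -- slice facts on `[0, T)`
  have hL2 : ∀ t ∈ Ico (0 : ℝ) T, scalarL2Sq (θ t) ≤ scalarL2Sq (θ 0) := fun t ht =>
    h.antitoneOn_scalarL2Sq hκ (a := 0) (b := t) (fun s hs => ⟨hs.1, lt_of_le_of_lt hs.2 ht.2⟩)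
      (left_mem_Icc.2 ht.1) (right_mem_Icc.2 ht.1) ht.1
  have hmem2 : ∀ t ∈ Ico (0 : ℝ) T, MemLp (θ t) 2 volume := fun t ht =>
    (hθs.isSmooth_slice ht).continuous.memLp_of_hasCompactSupport (HasCompactSupport.of_compactSpace _)
  have hsq : ∀ t ∈ Ico (0 : ℝ) T, ∫⁻ x, ‖θ t x‖ₑ ^ 2 = ENNReal.ofReal (scalarL2Sq (θ t)) := fun t ht =>
    lintegral_enorm_sq_eq_ofReal_scalarL2Sq (hmem2 t ht)
  obtain ⟨Cu, _, hCu⟩ := ae_ae_norm_le_of_memLp_top_stLift hu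
  have haeIco : ∀ᵐ t ∂(volume.restrict (Ioo (0 : ℝ) T)), t ∈ Ico (0 : ℝ) T := by
    filter_upwards [ae_restrict_mem measurableSet_Ioo] with t ht using Ioo_subset_Ico_self ht
  have huslice : ∀ᵐ t ∂(volume.restrict (Ioo (0 : ℝ) T)), ∫⁻ x, ‖u t x‖ₑ ^ 2 ≤ ENNReal.ofReal Cu ^ 2 := by
    filter_upwards [hCu] with t ht
    calc ∫⁻ x, ‖u t x‖ₑ ^ 2 ≤ ∫⁻ _ : UnitAddTorus d, ENNReal.ofReal Cu ^ 2 := by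
          refine lintegral_mono_ae ?_
          filter_upwards [ht] with x hx
          gcongr
          rw [← ofReal_norm]
          exact ENNReal.ofReal_le_ofReal hx
      _ = ENNReal.ofReal Cu ^ 2 := by rw [lintegral_const, measure_univ, mul_one]
  refine ⟨hθs.aestronglyMeasurable_stLift measurableSet_Ioo Ioo_subset_Ico_self, hu.1, ?_, ?_, ?_, ?_, ?_⟩
  · -- `θ ∈ L^∞_t L²_x`
    refine ⟨(scalarL2Sq (θ 0)).toNNReal, ?_⟩
    filter_upwards [haeIco] with t ht
    rw [hsq t ht]
    exact le_of_le_of_eq (ENNReal.ofReal_le_ofReal (hL2 t ht)) rfl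
  · -- `u ∈ L¹_t L²_x`
    calc ∫⁻ t in Ioo 0 T, (∫⁻ x, ‖u t x‖ₑ ^ 2) ^ (1 / 2 : ℝ)
        ≤ ∫⁻ _ in Ioo 0 T, (ENNReal.ofReal Cu ^ 2) ^ (1 / 2 : ℝ) := by
          refine lintegral_mono_ae ?_
          filter_upwards [huslice] with t ht
          exact ENNReal.rpow_le_rpow ht (by norm_num)
      _ < ⊤ := by
          rw [lintegral_const, Measure.restrict_apply_univ]
          exact ENNReal.mul_lt_top
            (ENNReal.rpow_lt_top_of_nonneg (by norm_num) (ENNReal.pow_ne_top ENNReal.ofReal_ne_top))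
            measure_Ioo_lt_top
  · -- `|u| |θ| ∈ L¹`
    have hsq1 : ∀ a : ℝ≥0∞, a ≤ a ^ 2 + 1 := fun a => by
      rcases le_total a 1 with h | h
      · exact h.trans le_add_self
      · calc a = a * 1 := (mul_one a).symm
          _ ≤ a * a := mul_le_mul' le_rfl h
          _ = a ^ 2 := (sq a).symm
          _ ≤ a ^ 2 + 1 := le_self_add
    have hb : ∀ᵐ t ∂(volume.restrict (Ioo (0 : ℝ) T)), ∫⁻ x, ‖u t x‖ₑ * ‖θ t x‖ₑ ≤
        ENNReal.ofReal Cu * (ENNReal.ofReal (scalarL2Sq (θ 0)) + 1) := by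
      filter_upwards [hCu, haeIco] with t ht htI
      calc ∫⁻ x, ‖u t x‖ₑ * ‖θ t x‖ₑ ≤ ∫⁻ x, ENNReal.ofReal Cu * (‖θ t x‖ₑ ^ 2 + 1) := by
            refine lintegral_mono_ae ?_
            filter_upwards [ht] with x hx
            refine mul_le_mul' ?_ (hsq1 _)
            rw [← ofReal_norm]
            exact ENNReal.ofReal_le_ofReal hx
        _ = ENNReal.ofReal Cu * ((∫⁻ x, ‖θ t x‖ₑ ^ 2) + 1) := by
            rw [lintegral_const_mul' _ _ ENNReal.ofReal_ne_top, lintegral_add_right _ measurable_const,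
              lintegral_const, measure_univ, mul_one]
        _ ≤ ENNReal.ofReal Cu * (ENNReal.ofReal (scalarL2Sq (θ 0)) + 1) := by
            rw [hsq t htI]
            gcongr
            exact hL2 t htI
    calc ∫⁻ t in Ioo 0 T, ∫⁻ x, ‖u t x‖ₑ * ‖θ t x‖ₑ
        ≤ ∫⁻ _ in Ioo 0 T, ENNReal.ofReal Cu * (ENNReal.ofReal (scalarL2Sq (θ 0)) + 1) := lintegral_mono_ae hb
      _ < ⊤ := by
          rw [lintegral_const, Measure.restrict_apply_univ]
          refine ENNReal.mul_lt_top (ENNReal.mul_lt_top ENNReal.ofReal_lt_top ?_) measure_Ioo_lt_top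
          exact ENNReal.add_lt_top.2 ⟨ENNReal.ofReal_lt_top, ENNReal.one_lt_top⟩
  · -- weak incompressibility
    filter_upwards [haeIco] with t ht
    exact FunctionSpaces.Torus.IsDivFree.isWeaklyDivFree_holds (hus.isSmooth_slice ht) (h.divFree t ht)
  · -- the weak identity: reduce to the closed interval `[0, T'']`
    intro ψ hψ
    obtain ⟨hψs, T', hT'T, hψ0⟩ := hψ
    set T₁ : ℝ := max T' 0 with hT₁
    have hT₁T : T₁ < T := max_lt hT'T hT
    have hψ1 : ∀ t, T₁ ≤ t → ψ t = 0 := fun t ht => hψ0 t ((le_max_left _ _).trans ht)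
    set T'' : ℝ := (T₁ + T) / 2 with hT''
    have h1 : T₁ < T'' := by rw [hT'']; linarith
    have h2 : T'' < T := by rw [hT'']; linarith
    have hT''0 : 0 ≤ T'' := ((le_max_right _ _).trans h1.le)
    have hsub : Icc 0 T'' ⊆ Ico (0 : ℝ) T := fun s hs => ⟨hs.1, lt_of_le_of_lt hs.2 h2⟩
    have hw : IsWeakScalarTransportOn T'' κ u (θ 0) θ :=
      IsClassicalScalarTransportOn.isWeakScalarTransportOn_holds h hsub
    have htest : FunctionSpaces.Torus.IsSpaceTimeTest T'' ψ := ⟨hψs, T₁, h1, hψ1⟩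
    have hid := hw.weak_eq ψ htest
    have hzero : ∀ t, T'' ≤ t →
        (∫ x, θ t x * (FunctionSpaces.Torus.timeDeriv ψ t x +
          ⟪u t x, FunctionSpaces.Torus.gradient (ψ t) x⟫_ℝ + κ * FunctionSpaces.Torus.laplacian (ψ t) x)) = 0 := by
      intro t ht
      have hT₁t : T₁ < t := lt_of_lt_of_le h1 ht
      have hψt : ψ t = 0 := hψ1 t hT₁t.le
      have hd : ∀ x, FunctionSpaces.Torus.timeDeriv ψ t x = 0 := fun x =>
        DEIJ.timeDeriv_eq_zero_of_forall_eq_zero hψ1 hT₁t x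
      have hlift : ∀ x : UnitAddTorus d,
          FunctionSpaces.Torus.liftAt (0 : UnitAddTorus d → ℝ) x = fun _ => (0 : ℝ) := fun x => by
        funext v
        simp [FunctionSpaces.Torus.liftAt]
      have hg : ∀ x, FunctionSpaces.Torus.gradient (ψ t) x = 0 := fun x => by
        rw [hψt, FunctionSpaces.Torus.gradient, hlift x]
        exact gradient_fun_const _ _
      have hl : ∀ x, FunctionSpaces.Torus.laplacian (ψ t) x = 0 := fun x => by
        rw [hψt, FunctionSpaces.Torus.laplacian, hlift x]
        simp
      simp [hd, hg, hl]
    have heq : (∫ t in Ioo 0 T, ∫ x, θ t x * (FunctionSpaces.Torus.timeDeriv ψ t x +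
          ⟪u t x, FunctionSpaces.Torus.gradient (ψ t) x⟫_ℝ + κ * FunctionSpaces.Torus.laplacian (ψ t) x)) =
        ∫ t in Ioo 0 T'', ∫ x, θ t x * (FunctionSpaces.Torus.timeDeriv ψ t x +
          ⟪u t x, FunctionSpaces.Torus.gradient (ψ t) x⟫_ℝ + κ * FunctionSpaces.Torus.laplacian (ψ t) x) :=
      setIntegral_eq_of_subset_of_forall_sdiff_eq_zero measurableSet_Ioo (Ioo_subset_Ioo_right h2.le)
        fun t ht => hzero t (not_lt.1 fun hlt => ht.2 ⟨ht.1.1, hlt⟩)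
    rw [heq]
    exact hid

/-! ## The stub -/

/-- **STUB 3 `stub_criterionTransfer`** of line `Birth` of the aside `K1BoundedStrainCascade`
(stmt-AnomalousDissipation-20026; reshape r1, `FieldRegular` / `BalancedInviscid` unfolded): at every parameter point,
field regularity and the inviscid balanced-growth package give `K1FixedFraction P`, with
`χ = 1/(32 C² ‖sin 2πx₁‖²_{L²})` and `κ₀ = 1` — the tree's DEIJ / Elgindi–Liss criterion
`Torus.DEIJ.le_eScalarDissipation_of_balanced_growth` at horizon `1` for the weak solution supplied by
`isWeakScalarTransportOn_of_Ico`, datum `θ₀ = datum = g 0`.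
[cite: DrivasEtAl2022, Prop. 1.3 and §2.1] -/
theorem stub_criterionTransfer :
    ∀ P : CascadeParams,
      CascadeFieldSmooth P ∧
          MemLp (FunctionSpaces.Torus.stLift P.field) ∞ (volume.restrict (Ioo (0 : ℝ) 1 ×ˢ univ)) →
      (∃ C : ℝ, 0 < C ∧ ∃ g : ℝ → UnitAddTorus (Fin 2) → ℝ, g 0 = datum ∧
        (∀ T₁ < (1 : ℝ), ∃ G : ℝ → UnitAddTorus (Fin 2) → ℝ, FunctionSpaces.Torus.IsSmoothSpaceTimeOn univ G ∧
            (∀ t ≤ T₁, G t = g t) ∧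
            ∀ t ∈ Icc 0 T₁, ∀ x, FunctionSpaces.Torus.timeDerivWithin univ G t x +
              ⟪P.field t x, FunctionSpaces.Torus.gradient (G t) x⟫_ℝ = 0) ∧
        (∀ t ∈ Ico (0 : ℝ) 1, ∫ x, g t x ^ 2 ≤ ∫ x, g 0 x ^ 2) ∧
        (∀ A : ℝ, ∃ t ∈ Ico (0 : ℝ) 1, A ≤ ∫ s in (0 : ℝ)..t, FluidPDE.Torus.scalarGradNormSq (g s)) ∧
        (∀ t ∈ Ico (0 : ℝ) 1,
          ∫ x, FunctionSpaces.Torus.laplacian (g t) x ^ 2 ≤ (C * FluidPDE.Torus.scalarGradNormSq (g t)) ^ 2)) →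
      K1FixedFraction P := by
  rintro P ⟨-, hu⟩ ⟨C, hC, g, hg0, hg, hL2, hgrow, hbal⟩
  have hLpos : 0 < scalarL2Sq datum := by rw [K1Start.scalarL2Sq_datum]; norm_num
  have hθ₀ : MemLp datum 2 volume :=
    K1Start.continuous_datum.memLp_of_hasCompactSupport (HasCompactSupport.of_compactSpace _)
  have hδ : ∫ x, (datum x - g 0 x) ^ 2 ≤ 1 / (8 * C ^ 2) := by
    rw [hg0]
    simp only [sub_self, ne_eq, OfNat.ofNat_ne_zero, not_false_eq_true, zero_pow, integral_zero]
    positivity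
  refine ⟨1 / (32 * C ^ 2) / scalarL2Sq datum, by positivity, 1, one_pos, fun κ hκ w hw hw0 => ?_⟩
  have hweak : IsWeakScalarTransportOn 1 κ P.field datum w := by
    rw [← hw0]
    exact isWeakScalarTransportOn_of_Ico one_pos hw hκ.1.le hu
  have key := DEIJ.le_eScalarDissipation_of_balanced_growth (T := 1) hC hu hg hL2 hgrow hbal hθ₀ hδ hκ.1 hweak
  have e : 1 / (32 * C ^ 2) / scalarL2Sq datum * scalarL2Sq datum = 1 / (32 * C ^ 2) :=
    div_mul_cancel₀ _ hLpos.ne'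
  calc ENNReal.ofReal (1 / (32 * C ^ 2) / scalarL2Sq datum * scalarL2Sq datum)
      = ENNReal.ofReal (1 / (32 * C ^ 2)) := by rw [e]
    _ ≤ eScalarDissipation κ w 0 1 := key
    _ ≤ 2 * eScalarDissipation κ w 0 1 := le_mul_of_one_le_left' (by norm_num)

end Summit.AnomalousDissipation.AnomalousDissipation.Theorems.SawtoothPulseCascade.K1BoundedStrainCascadeBirth

end
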